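import Literature.AnabelianGeometry.SemiGraphs.ArithBranchActionConsequences
import Literature.AnabelianGeometry.SemiGraphs.ArithIntersectionOfActionAt
import Literature.AnabelianGeometry.SemiGraphs.ArithChartActionAmple
import Literature.AnabelianGeometry.SemiGraphs.ArithLevelDataCptThm54
import Literature.AnabelianGeometry.SemiGraphs.TemperedCompactInVerticialAtBridge
import HarnessLib

/-!
# [SemiAnbd] Thm 5.4 (i) ∧ (ii) for the PRODUCED decomposition data — weakest producible currency

Mochizuki, *Semi-graphs of anabelioids*, Publ. RIMS **42** (2006) 221–322, §5, Thm 5.4 (i)(ii) p. 66,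
for the decomposition data `Π^temp_{𝔊,v}`, `Π^temp_{𝔊,b}` of p. 65; Def 5.1 (i) p. 62; Rmk 5.3.1 p. 65.
[cite: MochizukiSemiAnbd2006, Thm 5.4 (i)(ii), p. 66]

PROOF-ONLY umbrella v3 (abc-iut cell, L3 sub-DAG `plan/L3/SUBDAG-SemiAnbd-Thm54.md`, row «T54
umbrella-Cpt», seat abc-iut-w4-d040; position (A54) of abc-iut-w4-d085 / owner decision abc-iut-w4-d053
2026-08-26).  No definition, no new named fact.  Same composition as `ArithThm54OfBranchAction.lean`,
with the arithmetic level data taken in the WEAKER package `ArithLevelDataCpt` ((AI4′) `stabBranchPair`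
replaced by the aug-image form (AI4″) `stabBranchPairAug` for COMPACT subgroups — the only form the
tower produces, and all that Thm 5.4 consumes: print moves a compact arithmetically ample `H` only,
p. 66) through abc-iut-w4-d085's twins `ArithLevelDataCpt.arithMaximalCompactStatementI_of` / `…II_of`,
and the chart action in the branch-granular package `ArithChartBranchAction` (abc-iut-w4-d053), whose
clause (BR) discharges `hconjPair` (`ArithChartBranchAction.hconjPair`, this seat):

* **`arithMaximalCompactStatementI_and_II_ofChart_of_branchActionCptAt`** — Thm 5.4 (i) ∧ (ii) for
  `decompositionDataOfChart R ι`, CONDITIONAL on: `L : ArithLevelDataCpt …`, `A : ArithChartBranchAction …`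
  (producer debt T54-B), the LEVEL-B compactness `hVc`/`hBc`, Thm 3.7 (iii) at `𝒢`
  (`CompactInVerticialAt 𝒢`), and the print hypotheses (`Thm37Hypotheses`, `IsGraph`, total arithmetic
  estrangement `hest`, `hbot`, Prop 5.2 (iv): `hι`, `hexact`, `hsurj`);
* `…_of_finiteLevelData` — Thm 3.7 (iii) supplied by finite-level data at one chart;
* `arithMaximalCompactStatementI_and_II_ofChart_of_branchActionCpt` — the ∀-graph form
  (`CompactInVerticial`);
* `ArithLevelData` inputs are recovered through `ArithLevelData.toCpt` (`…_of_branchActionAt'`).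

Nothing here takes a side on [IUTchIII] Cor. 3.12; typed ≠ proved for the packages themselves.
-/

namespace Literature.AnabelianGeometry.SemiGraphs

namespace ProfiniteSemiGraph

open CategoryTheory Topology
open scoped Pointwise

universe v u u''

variable {𝒢 : ProfiniteSemiGraph.{u}} {c : TemperedPiChart 𝒢}
  {Gtp : Type u} [Group Gtp] [TopologicalSpace Gtp] [IsTopologicalGroup Gtp] [T2Space Gtp]
  {PA : Type u''} [Group PA] [TopologicalSpace PA] [IsTopologicalGroup PA]
  {ι : c.G →* Gtp} {aug : Gtp →* PA}
  {actV : PA → 𝒢.graph.Vertex → 𝒢.graph.Vertex} {actE : PA → 𝒢.graph.Edge → 𝒢.graph.Edge}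
  {actB : PA → 𝒢.graph.Branch → 𝒢.graph.Branch}

/-- **[SemiAnbd] Thm 5.4 (i) ∧ (ii) for the PRODUCED decomposition data, weakest producible currency,
AT ONE GRAPH**: over `ArithLevelDataCpt` ((AI4″) for compact subgroups) and `ArithChartBranchAction`
(Def 5.1 (i) on the chart, branch form), with `hconjPair` discharged by (BR).  CONDITIONAL on the two
packages, on `hVc`/`hBc`, on `CompactInVerticialAt 𝒢`, and on the print hypotheses (module docstring).
[cite: MochizukiSemiAnbd2006, Thm 5.4 (i)(ii), p. 66] -/
theorem arithMaximalCompactStatementI_and_II_ofChart_of_branchActionCptAt (h : CompactInVerticialAt 𝒢)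
    (h𝒢 : 𝒢.Thm37Hypotheses) (hG : 𝒢.graph.IsGraph) (R : ChartRepresentatives c)
    (hι : Function.Injective ι) (hexact : ι.range = aug.ker) (hsurj : Function.Surjective aug)
    {baseAct : PA →* Aut 𝒢.graph}
    (L : ArithLevelDataCpt.{v} 𝒢.graph (decompositionDataOfChart R ι) aug baseAct)
    (A : ArithChartBranchAction c ι aug actV actE actB)
    (hest : IsTotallyArithEstranged (decompositionDataOfChart R ι) aug) (hbot : ¬ IsArithAmple aug ⊥)
    (hVc : ∀ v, IsCompact (arithVertGp R ι v : Set Gtp))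
    (hBc : ∀ b, IsCompact (arithBrGp R ι b : Set Gtp)) :
    ArithMaximalCompactStatementI (decompositionDataOfChart R ι) aug ∧
      ArithMaximalCompactStatementII (decompositionDataOfChart R ι) aug := by
  have habuts := abut_isSome_of_isGraph R ι hG
  have hιaug : ∀ h : c.G, aug (ι h) = 1 := fun h => by
    rw [← MonoidHom.mem_ker, ← hexact]; exact ⟨h, rfl⟩
  -- Rmk 5.3.1, first sentence, at LEVEL A (row T54-1), `hconjPair` supplied by (c1)
  have hR : VerticialEdgeLikeCompactAmpleStatement (decompositionDataOfChart R ι) aug :=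
    A.toArithChartAction.verticialEdgeLikeCompactAmple R hιaug hsurj hG
      (fun b v hb => A.hconjPair h h𝒢 hG R hsurj b v hb) hVc hBc
  exact ⟨L.arithMaximalCompactStatementI_of habuts hest hbot,
    L.arithMaximalCompactStatementII_of habuts hest hbot hR fun _ hK =>
      not_isEdgeLike_of_isVerticial_ofChart_of_actionAt h h𝒢 hG R ι hι aug hexact
        A.toArithChartAction hK⟩

/-- **The same with Thm 3.7 (iii) supplied by FINITE-LEVEL DATA at one chart** (abc-iut-w4-d075's bridge
`compactInVerticialAt_of_finiteLevelData`). [cite: MochizukiSemiAnbd2006, Thm 5.4 (i)(ii), p. 66] -/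
theorem arithMaximalCompactStatementI_and_II_ofChart_of_branchActionCpt_of_finiteLevelData
    (hD : ∃ c₀ : TemperedPiChart 𝒢, Nonempty (FiniteLevelData.{v} 𝒢 c₀))
    (h𝒢 : 𝒢.Thm37Hypotheses) (hG : 𝒢.graph.IsGraph) (R : ChartRepresentatives c)
    (hι : Function.Injective ι) (hexact : ι.range = aug.ker) (hsurj : Function.Surjective aug)
    {baseAct : PA →* Aut 𝒢.graph}
    (L : ArithLevelDataCpt.{v} 𝒢.graph (decompositionDataOfChart R ι) aug baseAct)
    (A : ArithChartBranchAction c ι aug actV actE actB)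
    (hest : IsTotallyArithEstranged (decompositionDataOfChart R ι) aug) (hbot : ¬ IsArithAmple aug ⊥)
    (hVc : ∀ v, IsCompact (arithVertGp R ι v : Set Gtp))
    (hBc : ∀ b, IsCompact (arithBrGp R ι b : Set Gtp)) :
    ArithMaximalCompactStatementI (decompositionDataOfChart R ι) aug ∧
      ArithMaximalCompactStatementII (decompositionDataOfChart R ι) aug :=
  arithMaximalCompactStatementI_and_II_ofChart_of_branchActionCptAt
    (compactInVerticialAt_of_finiteLevelData hD) h𝒢 hG R hι hexact hsurj L A hest hbot hVc hBc

/-- **∀-graph form** (Thm 3.7 (iii) as the frozen named fact `CompactInVerticial`).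
[cite: MochizukiSemiAnbd2006, Thm 5.4 (i)(ii), p. 66] -/
theorem arithMaximalCompactStatementI_and_II_ofChart_of_branchActionCpt (hCV : CompactInVerticial.{u})
    (h𝒢 : 𝒢.Thm37Hypotheses) (hG : 𝒢.graph.IsGraph) (R : ChartRepresentatives c)
    (hι : Function.Injective ι) (hexact : ι.range = aug.ker) (hsurj : Function.Surjective aug)
    {baseAct : PA →* Aut 𝒢.graph}
    (L : ArithLevelDataCpt.{v} 𝒢.graph (decompositionDataOfChart R ι) aug baseAct)
    (A : ArithChartBranchAction c ι aug actV actE actB)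
    (hest : IsTotallyArithEstranged (decompositionDataOfChart R ι) aug) (hbot : ¬ IsArithAmple aug ⊥)
    (hVc : ∀ v, IsCompact (arithVertGp R ι v : Set Gtp))
    (hBc : ∀ b, IsCompact (arithBrGp R ι b : Set Gtp)) :
    ArithMaximalCompactStatementI (decompositionDataOfChart R ι) aug ∧
      ArithMaximalCompactStatementII (decompositionDataOfChart R ι) aug :=
  arithMaximalCompactStatementI_and_II_ofChart_of_branchActionCptAt (hCV 𝒢) h𝒢 hG R hι hexact hsurj L A
    hest hbot hVc hBc

/-- The `ArithLevelData` umbrella of `ArithThm54OfBranchAction.lean` RECOVERED through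
`ArithLevelData.toCpt` (an ∀g-dictionary restricts to every compact `C`): the Cpt currency loses nothing.
[cite: MochizukiSemiAnbd2006, Thm 5.4 (i)(ii), p. 66] -/
theorem arithMaximalCompactStatementI_and_II_ofChart_of_branchActionAt' (h : CompactInVerticialAt 𝒢)
    (h𝒢 : 𝒢.Thm37Hypotheses) (hG : 𝒢.graph.IsGraph) (R : ChartRepresentatives c)
    (hι : Function.Injective ι) (hexact : ι.range = aug.ker) (hsurj : Function.Surjective aug)
    {baseAct : PA →* Aut 𝒢.graph}
    (L : ArithLevelData.{v} 𝒢.graph (decompositionDataOfChart R ι) aug baseAct)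
    (A : ArithChartBranchAction c ι aug actV actE actB)
    (hest : IsTotallyArithEstranged (decompositionDataOfChart R ι) aug) (hbot : ¬ IsArithAmple aug ⊥)
    (hVc : ∀ v, IsCompact (arithVertGp R ι v : Set Gtp))
    (hBc : ∀ b, IsCompact (arithBrGp R ι b : Set Gtp)) :
    ArithMaximalCompactStatementI (decompositionDataOfChart R ι) aug ∧
      ArithMaximalCompactStatementII (decompositionDataOfChart R ι) aug :=
  arithMaximalCompactStatementI_and_II_ofChart_of_branchActionCptAt h h𝒢 hG R hι hexact hsurj L.toCpt A
    hest hbot hVc hBc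

end ProfiniteSemiGraph

end Literature.AnabelianGeometry.SemiGraphs
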